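import Mathlib
import Literature.NumberTheory.LFunctions.Zhang2022.TypedSection10C
import Literature.NumberTheory.LFunctions.Zhang2022.Section10MainTerms
import Literature.NumberTheory.LFunctions.Zhang2022.Section10cExpandSplit
import HarnessLib

/-!
# Zhang (2022) §10c, discharged bookkeeping II: "Gathering the above results together" for
# `S_j(𝐚₁₄,𝐚₂₂)` (DAG node Z22:§10.u051) from the five range claims, with its exact main term,
# and the exact form of "`β_{j+1}β_{j+2}log P = −(11−6j+j²)πα + o(α)`" (Z22:§10.u039)

Topic `Literature/NumberTheory/LFunctions/Zhang2022` (Landau–Siegel audit tree; verdict-neutral).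
Y. Zhang, *Discrete mean estimates and the Landau–Siegel zero*, arXiv:2211.02515v1 (2022)
[Zhang2022LandauSiegel], §10 pp. 58–60 — **an unrefereed manuscript under adjudication; this file
asserts nothing about its Theorems 1–2.** D-0069 campaign, discharge layer L3 (seat sz-d34).

What is PROVED here (kernel-checked implications between the typed CLAIM nodes of `TypedSection10C`,
plus exact identities between the printed constants; no analytic number theory):

| DAG node | locator | theorem | content |
|---|---|---|---|
| `Z22:§10.u051` | p.60, tex L3050 | `gather1422_of_ranges` | the five range claims of pp.59–60 (`Low1422Small`, `Mid1422Eval`, `Mid1422Int`, `Top1422Eval`, `Top1422Int`) ⊢ `Gather1422 c′`: "`α⁻¹S_j(𝐚₁₄,𝐚₂₂) = (d′_{5j} + d_{5j})𝔞 + o(1)`" |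
| (its main term) | p.60 | `gather1422_main` | `α⁻¹(midInt1422 + topInt1422) = (d′_{5j} + d_{5j})𝔞` EXACTLY (`u = 0.498 − z`, `u = 0.5 − z`, regrouping; cf. the tree's main-order `Section10MainTerms.S1422_eq_d5F`) |
| `Z22:§10.u039`-type input | p.58, tex L2945 | `betaJ_pair` | `β_{j+1}β_{j+2} = −n_jα²(1 + E_j)`, `n_j = 11−6j+j² = 6, 3, 2`, `|E_j| ≤ 6|c′α𝓛| + 5(c′α𝓛)²` (the exact content of the printed `o(α)`; `α𝓛 = π𝓛⁻⁸`, `alpha_mul_ell`) |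

The expansion (u047) and split (u048) it consumes are the theorems `sjExpand1422_holds`,
`split1422_holds` of `Section10cExpandSplit`. The range claims themselves (shifted Lemma 10.1,
Lemmas 8.2–8.4, the §8 summation rule) remain CLAIM nodes / hypotheses; the composition with
"Hence, by Proposition 7.1" is `Section10cGather1214.ded1014_holds`. Also here: continuity of the
printed profiles `𝔣𝔣, 𝔤𝔥, 𝔶𝔶` and the small parameter facts `log P > 0`, `α > 0`, `𝓛 > 3` (`D ≥ 21`)
used by the sibling files.

## References

* Y. Zhang, arXiv:2211.02515v1 (2022), §10 pp. 58–60, (10.14); §2 (2.1), (2.6), (2.10), (2.13).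
  [cite: Zhang2022LandauSiegel, §10 pp. 58–60]
-/

noncomputable section

open Complex Real ComplexConjugate
open Literature.NumberTheory.LFunctions.Zhang2022.Skeleton

namespace Literature.NumberTheory.LFunctions.Zhang2022.Typed.Sec10C

section D34Gather1422

/-! ### Continuity of the printed profiles -/

/-- `𝔤𝔥_{j6}` is continuous. [cite: Zhang2022LandauSiegel, §8 (8.13)–(8.15)] -/
@[fun_prop] theorem continuous_ghJ6 (j : ℕ) : Continuous (ghJ6 j) := by
  unfold ghJ6 byJ gh16 gh26 gh36; split_ifs <;> fun_prop

/-- `𝔤𝔥_{j7}` is continuous. [cite: Zhang2022LandauSiegel, §8 (8.16)–(8.18)] -/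
@[fun_prop] theorem continuous_ghJ7 (j : ℕ) : Continuous (ghJ7 j) := by
  unfold ghJ7 byJ gh17 gh27 gh37; split_ifs <;> fun_prop

/-- `𝔣𝔣_{j6}` is continuous. [cite: Zhang2022LandauSiegel, §8 (8.13)–(8.15)] -/
@[fun_prop] theorem continuous_ffJ6 (j : ℕ) : Continuous (ffJ6 j) := by
  unfold ffJ6 byJ ff16 ff26 ff36; split_ifs <;> fun_prop

/-- `𝔣𝔣_{j7}` is continuous. [cite: Zhang2022LandauSiegel, §8 (8.16)–(8.18)] -/
@[fun_prop] theorem continuous_ffJ7 (j : ℕ) : Continuous (ffJ7 j) := by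
  unfold ffJ7 byJ ff17 ff27 ff37; split_ifs <;> fun_prop

/-- `𝔶𝔶_{1j}` is continuous. [cite: Zhang2022LandauSiegel, §10 p. 57] -/
@[fun_prop] theorem continuous_yyJ1 (j : ℕ) : Continuous (yyJ1 j) := by
  unfold yyJ1 byJ yy11 yy12 yy13; split_ifs <;> fun_prop

/-- `𝔶𝔶_{2j}` is continuous. [cite: Zhang2022LandauSiegel, §10 p. 57] -/
@[fun_prop] theorem continuous_yyJ2 (j : ℕ) : Continuous (yyJ2 j) := by
  unfold yyJ2 byJ yy21 yy22 yy23; split_ifs <;> fun_prop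

/-- `d′_{5j} = d5pF(𝔤𝔥_{j6})` for every index (the selector sends `j ∉ {1,2}` to the third entry on
both sides). [cite: Zhang2022LandauSiegel, §10 p. 60] -/
theorem d5pJ_eq (j : ℕ) : d5pJ j = d5pF (ghJ6 j) := by
  unfold d5pJ ghJ6 byJ d5p1 d5p2 d5p3; split_ifs <;> rfl

/-- `d_{5j} = d5F j 𝔤𝔥_{j6} 𝔤𝔥_{j7}` for `j = 1, 2, 3`. [cite: Zhang2022LandauSiegel, §10 p. 60] -/
theorem d5J_eq {j : ℕ} (hj : j ∈ ({1, 2, 3} : Finset ℕ)) : d5J j = d5F j (ghJ6 j) (ghJ7 j) := by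
  simp only [Finset.mem_insert, Finset.mem_singleton] at hj
  rcases hj with rfl | rfl | rfl <;> rfl

/-- `d′_{6j} = d6pF(𝔣𝔣_{j6})` for every index. [cite: Zhang2022LandauSiegel, §10 (10.15) p. 61] -/
theorem d6pJ_eq (j : ℕ) : d6pJ j = d6pF (ffJ6 j) := by
  unfold d6pJ ffJ6 byJ d6p1 d6p2 d6p3; split_ifs <;> rfl

/-- **Z22:§10.u039-type input, exact form**: for `j = 1, 2, 3` the shifts (2.13) give
`β_{j+1}β_{j+2} = −n_jα²(1 + E_j)` with `n_j = 11 − 6j + j² = 6, 3, 2` and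
`|E_j| ≤ 6|c′α𝓛| + 5(c′α𝓛)²` (`E₁ = −u²`, `E₂ = −6u + 5u²`, `E₃ = −4u − 5u²`, `u = c′α𝓛`) — the exact
content of the printed "`β_{j+1}β_{j+2}log P = −(11 − 6j + j²)πα + o(α)`"; packaged with the tree's
`d_{6j} = d6F n_j …` (`d6J_spec`). [cite: Zhang2022LandauSiegel, §10 p. 58] -/
theorem betaJ_pair (c' : ℝ) (D : ℕ) {j : ℕ} (hj : j ∈ ({1, 2, 3} : Finset ℕ)) :
    ∃ n : ℕ, ∃ E : ℝ, d6J j = d6F n (ffJ6 j) (ffJ7 j) (yyJ1 j) (yyJ2 j) ∧ (n : ℝ) ≤ 6 ∧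
      |E| ≤ 6 * |c' * alpha D * ell D| + 5 * (c' * alpha D * ell D) ^ 2 ∧
      betaJ c' D (j + 1) * betaJ c' D (j + 2) =
        -((((n : ℝ) * alpha D ^ 2 * (1 + E) : ℝ)) : ℂ) := by
  simp only [Finset.mem_insert, Finset.mem_singleton] at hj
  set u : ℝ := c' * alpha D * ell D with hu
  have h0 : 0 ≤ |u| := abs_nonneg _
  have hu2 : 0 ≤ u ^ 2 := sq_nonneg _
  have e6 : |(-6 : ℝ) * u| = 6 * |u| := by rw [abs_mul]; norm_num
  have e4 : |(-4 : ℝ) * u| = 4 * |u| := by rw [abs_mul]; norm_num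
  have e5 : |(5 : ℝ) * u ^ 2| = 5 * u ^ 2 := by rw [abs_mul, abs_pow, sq_abs]; norm_num
  rcases hj with rfl | rfl | rfl
  · refine ⟨6, -u ^ 2, rfl, by norm_num, ?_, ?_⟩
    · rw [abs_neg, abs_pow, sq_abs]; nlinarith
    · simp only [betaJ, beta2, beta3, hu]
      norm_num
      linear_combination (6 * (alpha D : ℂ) ^ 2 * (1 - ((c' : ℂ) * alpha D * ell D) ^ 2)) * I_sq
  · refine ⟨3, -6 * u + 5 * u ^ 2, rfl, by norm_num, ?_, ?_⟩
    · calc |-6 * u + 5 * u ^ 2| ≤ |(-6 : ℝ) * u| + |(5 : ℝ) * u ^ 2| := abs_add_le _ _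
        _ = 6 * |u| + 5 * u ^ 2 := by rw [e6, e5]
    · simp only [betaJ, beta3, beta1, hu]
      norm_num
      linear_combination (3 * (alpha D : ℂ) ^ 2 * ((1 - (c' : ℂ) * alpha D * ell D) *
        (1 - 5 * ((c' : ℂ) * alpha D * ell D)))) * I_sq
  · refine ⟨2, -4 * u - 5 * u ^ 2, rfl, by norm_num, ?_, ?_⟩
    · calc |-4 * u - 5 * u ^ 2| ≤ |(-4 : ℝ) * u| + |(5 : ℝ) * u ^ 2| := abs_sub _ _
        _ = 4 * |u| + 5 * u ^ 2 := by rw [e4, e5]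
        _ ≤ 6 * |u| + 5 * u ^ 2 := by nlinarith
    · simp only [betaJ, beta1, beta2, hu]
      norm_num
      linear_combination (2 * (alpha D : ℂ) ^ 2 * ((1 - 5 * ((c' : ℂ) * alpha D * ell D)) *
        (1 + (c' : ℂ) * alpha D * ell D))) * I_sq

/-! ### The exact main-term identity behind "Gathering" for `S_j(𝐚₁₄,𝐚₂₂)` -/

/-- The middle-range `z`-integral after `u = 0.498 − z`, split into its four pieces
(`z − 0.496 = 0.002 − u`, `0.5 − z = 0.002 + u`). [cite: Zhang2022LandauSiegel, §10 p. 59] -/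
theorem midInt1422_pieces (j : ℕ) :
    (∫ z in (0.496 : ℝ)..0.498,
      (-1 - π * I * j * ((z - 0.496 : ℝ) : ℂ)) *
        (iota3 / 0.498 * ghJ6 j (0.498 - z) + iota4 / 0.5 * ghJ7 j (0.5 - z)))
      = -(iota3 / 0.498) * (∫ u in (0:ℝ)..0.002, ghJ6 j u)
        + -(iota4 / 0.5) * (∫ u in (0:ℝ)..0.002, ghJ7 j (0.002 + u))
        + -((j : ℂ) * π * I * iota3 / 0.498) *
            (∫ u in (0:ℝ)..0.002, (((0.002 - u : ℝ)) : ℂ) * ghJ6 j u)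
        + -((j : ℂ) * π * I * iota4 / 0.5) *
            (∫ u in (0:ℝ)..0.002, (((0.002 - u : ℝ)) : ℂ) * ghJ7 j (0.002 + u)) := by
  have step1 : (∫ z in (0.496 : ℝ)..0.498,
      (-1 - π * I * j * ((z - 0.496 : ℝ) : ℂ)) *
        (iota3 / 0.498 * ghJ6 j (0.498 - z) + iota4 / 0.5 * ghJ7 j (0.5 - z)))
      = ∫ z in (0.496 : ℝ)..0.498,
          (fun u => (-1 - (j : ℂ) * π * I * (((0.002 - u : ℝ)) : ℂ))
            * (iota3 * ghJ6 j u / 0.498 + iota4 * ghJ7 j (0.002 + u) / 0.5)) (0.498 - z) := by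
    refine intervalIntegral.integral_congr fun z _ => ?_
    have h1 : (0.5 : ℝ) - z = 0.002 + (0.498 - z) := by ring
    have h2 : (z - 0.496 : ℝ) = 0.002 - (0.498 - z) := by ring
    simp only [h1, h2]
    push_cast
    ring
  rw [step1, intervalIntegral.integral_comp_sub_left
      (fun u => (-1 - (j : ℂ) * π * I * (((0.002 - u : ℝ)) : ℂ))
        * (iota3 * ghJ6 j u / 0.498 + iota4 * ghJ7 j (0.002 + u) / 0.5)) 0.498,
    sub_self, show (0.498:ℝ) - 0.496 = 0.002 by norm_num,
    ← intervalIntegral.integral_const_mul, ← intervalIntegral.integral_const_mul,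
    ← intervalIntegral.integral_const_mul, ← intervalIntegral.integral_const_mul,
    ← integral_add4 (by fun_prop) (by fun_prop) (by fun_prop) (by fun_prop)]
  exact intervalIntegral.integral_congr fun u _ => by push_cast; ring

/-- The top-range `z`-integral after `u = 0.5 − z`, split into its two pieces.
[cite: Zhang2022LandauSiegel, §10 p. 60] -/
theorem topInt1422_pieces (j : ℕ) :
    (∫ z in (0.498 : ℝ)..0.5, (1 - π * I * j * ((0.5 - z : ℝ) : ℂ)) * ghJ7 j (0.5 - z))
      = (∫ u in (0:ℝ)..0.002, ghJ7 j u)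
        + -((j : ℂ) * π * I) * (∫ u in (0:ℝ)..0.002, (u : ℂ) * ghJ7 j u) := by
  have step1 : (∫ z in (0.498 : ℝ)..0.5, (1 - π * I * j * ((0.5 - z : ℝ) : ℂ)) * ghJ7 j (0.5 - z))
      = ∫ z in (0.498 : ℝ)..0.5,
          (fun u => (1 - (j : ℂ) * π * I * ((u : ℝ) : ℂ)) * ghJ7 j u) (0.5 - z) := by
    refine intervalIntegral.integral_congr fun z _ => ?_
    simp only
    ring
  rw [step1, intervalIntegral.integral_comp_sub_left
      (fun u => (1 - (j : ℂ) * π * I * ((u : ℝ) : ℂ)) * ghJ7 j u) 0.5,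
    sub_self, show (0.5:ℝ) - 0.498 = 0.002 by norm_num,
    ← intervalIntegral.integral_const_mul, ← integral_add2 (by fun_prop) (by fun_prop)]
  exact intervalIntegral.integral_congr fun u _ => by ring

/-- **The main-term identity of "Gathering" for `S_j(𝐚₁₄,𝐚₂₂)`** (p. 60): for `j = 1, 2, 3` and
`log P > 0`, `α⁻¹·(midInt1422 + topInt1422) = (d′_{5j} + d_{5j})𝔞` EXACTLY (`α = π/log P`; the
substitutions `u = 0.498 − z`, `u = 0.5 − z` and regrouping; cf. the tree's main-order
`Section10MainTerms.S1422_eq_d5F`). [cite: Zhang2022LandauSiegel, §10 p. 60] -/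
theorem gather1422_main {D : ℕ} [NeZero D] (χ : DirichletCharacter ℂ D) {j : ℕ}
    (hj : j ∈ ({1, 2, 3} : Finset ℕ)) (hΛ : 0 < Real.log (bigP D)) :
    (alpha D : ℂ)⁻¹ * (midInt1422 χ j + topInt1422 χ j) = (d5pJ j + d5J j) * frakA χ := by
  have hΛ0 : (Real.log (bigP D) : ℂ) ≠ 0 := by exact_mod_cast hΛ.ne'
  have hπ0 : (π : ℂ) ≠ 0 := by exact_mod_cast Real.pi_ne_zero
  have hα : (alpha D : ℂ)⁻¹ = (Real.log (bigP D) : ℂ) / π := by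
    rw [alpha, Complex.ofReal_div, inv_div]
  have D7 : (∫ z in (0:ℝ)..0.002, (ghJ7 j z - ghJ7 j (0.002 + z)))
      = (∫ z in (0:ℝ)..0.002, ghJ7 j z) - ∫ z in (0:ℝ)..0.002, ghJ7 j (0.002 + z) :=
    integral_sub2 (by fun_prop) (by fun_prop)
  have L7 : (∫ z in (0:ℝ)..0.002,
        ((((0.002 - z : ℝ)) : ℂ) * ghJ7 j (0.002 + z) + (z : ℂ) * ghJ7 j z))
      = (∫ z in (0:ℝ)..0.002, (((0.002 - z : ℝ)) : ℂ) * ghJ7 j (0.002 + z))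
        + ∫ z in (0:ℝ)..0.002, (z : ℂ) * ghJ7 j z :=
    integral_add2 (by fun_prop) (by fun_prop)
  rw [d5pJ_eq, d5J_eq hj, midInt1422, topInt1422, midInt1422_pieces, topInt1422_pieces, hα]
  unfold d5pF d5F
  rw [D7, L7]
  generalize (∫ u in (0:ℝ)..0.002, ghJ6 j u) = A1
  generalize (∫ u in (0:ℝ)..0.002, ghJ7 j (0.002 + u)) = A2
  generalize (∫ u in (0:ℝ)..0.002, (((0.002 - u : ℝ)) : ℂ) * ghJ6 j u) = A3
  generalize (∫ u in (0:ℝ)..0.002, (((0.002 - u : ℝ)) : ℂ) * ghJ7 j (0.002 + u)) = A4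
  generalize (∫ u in (0:ℝ)..0.002, (u : ℂ) * ghJ7 j u) = A5
  generalize (∫ u in (0:ℝ)..0.002, ghJ7 j u) = A6
  push_cast
  field_simp
  ring

end D34Gather1422
section D34Gather1422b

/-- Norm of a five-term sum. [folklore] -/
private theorem norm_add5_le (a b c d e : ℂ) :
    ‖a + b + c + d + e‖ ≤ ‖a‖ + ‖b‖ + ‖c‖ + ‖d‖ + ‖e‖ := by
  calc ‖a + b + c + d + e‖ ≤ ‖a + b + c + d‖ + ‖e‖ := norm_add_le _ _
    _ ≤ ‖a + b + c‖ + ‖d‖ + ‖e‖ := by gcongr; exact norm_add_le _ _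
    _ ≤ ‖a + b‖ + ‖c‖ + ‖d‖ + ‖e‖ := by gcongr; exact norm_add_le _ _
    _ ≤ ‖a‖ + ‖b‖ + ‖c‖ + ‖d‖ + ‖e‖ := by gcongr; exact norm_add_le _ _

/-- `log P = 𝓛⁹ > 0` as soon as `D ≥ 2`. [cite: Zhang2022LandauSiegel, §2 (2.6)] -/
theorem log_bigP_pos {D : ℕ} (hD : 2 ≤ D) : 0 < Real.log (bigP D) := by
  rw [bigP, Real.log_exp]
  have h1 : (1 : ℝ) < D := by exact_mod_cast hD
  exact pow_pos (Real.log_pos h1) 9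

/-- Eventually (`D ≥ 2`) `log P > 0`. [cite: Zhang2022LandauSiegel, §2 (2.6)] -/
theorem forAllLarge_log_bigP_pos : ForAllLarge fun D _ _ => 0 < Real.log (bigP D) :=
  ⟨2, fun _ _ _ hD _ _ => log_bigP_pos hD⟩

/-- `α = π/log P > 0` when `log P > 0`. [cite: Zhang2022LandauSiegel, §2 (2.10)] -/
theorem alpha_pos {D : ℕ} (hΛ : 0 < Real.log (bigP D)) : 0 < alpha D := div_pos Real.pi_pos hΛ

/-- `‖(α : ℂ)⁻¹‖ = α⁻¹`. [cite: Zhang2022LandauSiegel, §2 (2.10)] -/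
theorem norm_inv_alpha {D : ℕ} (hΛ : 0 < Real.log (bigP D)) :
    ‖(alpha D : ℂ)⁻¹‖ = (alpha D)⁻¹ := by
  rw [norm_inv, Complex.norm_real, Real.norm_of_nonneg (alpha_pos hΛ).le]

/-- `𝓛 = log D > 3` as soon as `D ≥ 21` (`e³ < 21`). [cite: Zhang2022LandauSiegel, §2 (2.1)] -/
theorem three_lt_log_of_le {D : ℕ} (hD : 21 ≤ D) : 3 < Real.log D := by
  have h21 : (21 : ℝ) ≤ D := by exact_mod_cast hD
  have he : Real.exp 3 < 21 := by
    have h1 := Real.exp_one_lt_d9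
    have h3 : Real.exp 3 = Real.exp 1 ^ 3 := by rw [← Real.exp_nat_mul]; norm_num
    rw [h3]
    have h0 : 0 < Real.exp 1 := Real.exp_pos 1
    calc Real.exp 1 ^ 3 < (2.7182818286 : ℝ) ^ 3 := pow_lt_pow_left₀ h1 h0.le (by norm_num)
      _ < 21 := by norm_num
  exact (Real.lt_log_iff_exp_lt (by linarith)).mpr (he.trans_le h21)

/-- `α𝓛 = π𝓛⁻⁸` (`α = π/log P`, `log P = 𝓛⁹`). [cite: Zhang2022LandauSiegel, §2 (2.6), (2.10)] -/
theorem alpha_mul_ell {D : ℕ} (hℓ : 0 < ell D) : alpha D * ell D = π / ell D ^ 8 := by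
  rw [alpha, bigP, Real.log_exp]
  field_simp

/-- **Z22:§10.u051 as a kernel EDGE** [Z22 p.60, tex L3050]: "Gathering the above results together we
conclude `α⁻¹S_j(𝐚₁₄,𝐚₂₂) = (d′_{5j} + d_{5j})𝔞 + o(1)`" — PROVED from the five range claims of p. 59–60
(the low range is `o(α)`: `Low1422Small`; middle range `= midSum1422 + o(α) = midInt1422 + o(α)`:
`Mid1422Eval`, `Mid1422Int`; top range likewise: `Top1422Eval`, `Top1422Int`), via the expansion
(`sjExpand1422_holds`, u047), the split (`split1422_holds`, u048) and the exact identity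
`α⁻¹(midInt1422 + topInt1422) = (d′_{5j} + d_{5j})𝔞` (`gather1422_main`). The range claims themselves
(shifted Lemma 10.1, Lemmas 8.2–8.4 and the §8 evaluation rule) remain CLAIM nodes.
[cite: Zhang2022LandauSiegel, §10 p. 60] -/
theorem gather1422_of_ranges (c' : ℝ) (hLow : Low1422Small c') (hMidE : Mid1422Eval c')
    (hMidI : Mid1422Int c') (hTopE : Top1422Eval c') (hTopI : Top1422Int c') :
    Gather1422 c' := by
  intro ε hε
  have hε5 : 0 < ε / 5 := by positivity
  have H := (((((((sjExpand1422_holds c').and (split1422_holds c')).and (hLow _ hε5)).and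
    (hMidE _ hε5)).and (hMidI _ hε5)).and (hTopE _ hε5)).and (hTopI _ hε5)).and
    forAllLarge_log_bigP_pos
  refine H.mono fun D _ χ _ _ h hA j hj => ?_
  obtain ⟨⟨⟨⟨⟨⟨⟨e1, e2⟩, e3⟩, e4⟩, e5⟩, e6⟩, e7⟩, hΛ⟩ := h
  have hα := alpha_pos hΛ
  rw [← gather1422_main χ hj hΛ, ← mul_sub, norm_mul, norm_inv_alpha hΛ, e1 hA j hj, e2 hA j hj]
  have key : S1422On c' χ j 0 (bigP D ^ (0.496 : ℝ)) +
        S1422On c' χ j (bigP D ^ (0.496 : ℝ)) (bigP D ^ (0.498 : ℝ)) +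
        S1422On c' χ j (bigP D ^ (0.498 : ℝ)) (bigP D ^ (0.5 : ℝ)) -
        (midInt1422 χ j + topInt1422 χ j) =
      S1422On c' χ j 0 (bigP D ^ (0.496 : ℝ)) +
        (S1422On c' χ j (bigP D ^ (0.496 : ℝ)) (bigP D ^ (0.498 : ℝ)) - midSum1422 c' χ j) +
        (midSum1422 c' χ j - midInt1422 χ j) +
        (S1422On c' χ j (bigP D ^ (0.498 : ℝ)) (bigP D ^ (0.5 : ℝ)) - topSum1422 c' χ j) +
        (topSum1422 c' χ j - topInt1422 χ j) := by ring
  rw [key]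
  calc (alpha D)⁻¹ * ‖_‖
      ≤ (alpha D)⁻¹ * (ε / 5 * alpha D + ε / 5 * alpha D + ε / 5 * alpha D + ε / 5 * alpha D +
          ε / 5 * alpha D) := by
        refine mul_le_mul_of_nonneg_left ((norm_add5_le _ _ _ _ _).trans ?_) (inv_nonneg.mpr hα.le)
        gcongr
        · exact e3 hA j hj
        · exact e4 hA j hj
        · exact e5 hA j hj
        · exact e6 hA j hj
        · exact e7 hA j hj
    _ = ε := by field_simp; ring

end D34Gather1422b

end Literature.NumberTheory.LFunctions.Zhang2022.Typed.Sec10C
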